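import Summits.Ventures.YMGap.Thresholds.PressureSecondDerivative
import Summits.Ventures.YMGap.Thresholds.CouplingSecondDerivative
import HarnessLib

/-!
# The free energy density is `C³` on the open strong-coupling window, `f''' =` the summed connected three-point
# function of the plaquette field (row type C-PRESS3)

Cell `pub-ymgap`, seat ds-1 (gen 10). HONEST FRAMING: strong-coupling LATTICE statements for `SU(2)` Wilson lattice gauge
theory on `ℤ⁴`; `C³` regularity of the infinite-volume free energy density `f = freeEnergyDensity 4 ρ_{SU(2)}` in the
(tree) coupling — NOT analyticity; the window `(0, 9/50)` (Wilson `β_W = 2β < 9/25`) is where the one-sided vertex-star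
Dobrushin bound closes, not a transition; nothing about the continuum or the Clay problem. Kernel theorems only, 0 compute.

Part 2 (`PressureSecondDerivative.lean`, g9) proved `f''(β) = Σ_{i<j} 4 Σ_q Cov_{μ_β}(W_{p_ij}, W_q)` on `(0, 9/50)`. The
plaquette susceptibility is differentiated once more with this seat's C-DIFF2
(`CouplingResponse.su2_hasDerivAt_responseSum_star`: `d/dβ_W Σ_q Cov(F, W_q) = Σ_q Σ_r u₃(F; W_q; W_r)`):

* `su2_hasDerivAt_susceptibility_tree` — `d/dβ Σ_q Cov_{μ_β}(W_p, W_q) = 2 Σ_q Σ_r u₃(W_p; W_q; W_r)_{μ_β}` (tree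
  coupling `β = β_W/2`) on `(0, 9/50)`;
* ★★ `su2_hasDerivAt_deriv_deriv_freeEnergyDensity` — `f''` is differentiable at every `0 < β < 9/50` with
  `f'''(β) = Σ_{i<j} 4 · 2 · Σ_q Σ_r u₃(W_{p_ij}; W_q; W_r)_{μ_β}`, the (absolutely convergent, C-SUS3) summed
  connected three-point function of the unique DLR state; `su2_deriv_deriv_deriv_freeEnergyDensity_eq` — the
  identity for EVERY `ν ∈ 𝒢(β)`;
* `su2_continuousOn_thirdResponse` — `f'''` is continuous on `[0, 9/50]`;
* ★★ `su2_contDiffOn_three_freeEnergyDensity : ContDiffOn ℝ 3 (freeEnergyDensity 4 (fundamentalRep (Fin 2))) (Ioo 0 (9/50))`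
  — no first-, second- or THIRD-order transition in the strong-coupling window, as a kernel theorem about the
  thermodynamic potential.

References (mechanism): B. Simon, *The Statistical Mechanics of Lattice Gases* I (1993) §II.12; Friedli–Velenik 2017
Prop. 6.91. All inputs are tree theorems.
-/

noncomputable section

open MeasureTheory ProbabilityTheory Set Filter Topology
open scoped NNReal
open Literature.MathematicalPhysics.QuantumLattice (LGConfig ZdEdge ZdPlaquette fundamentalRep ymGibbsMeasures
  plaquetteEdges freeEnergyDensity)
open Literature.MathematicalPhysics.QuantumFieldTheory hiding ZdEdge

namespace Summit.Ventures.YMGap.PressureRegularity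

section SU2C3

open Summit.Ventures.YMGap.CouplingResponse (su2_hasDerivAt_responseSum_star su2_continuousOn_threePointSum
  exists_dlrSelection)

/-- Local shorthand: the planes `{(i, j) : i < j}` of `ℤ⁴`. -/
local notation3 (prettyPrint := false) "𝔓₄" => {q : Fin 4 × Fin 4 // q.1 < q.2}

/-- Local shorthand: the normalised plaquette observable `W_q = ½ Re tr U_q` of `SU(2)` on `ℤ⁴`. -/
local notation3 (prettyPrint := false) "W∗" q:max =>
  zdPlaquetteObs (d := 4) (fundamentalRep (Fin 2)) (Prod.fst q) (Prod.snd q).1.1 (Prod.snd q).1.2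

/-- ★ **The plaquette susceptibility is differentiable in the tree coupling**: along any DLR selection on
`[0, 9/50]`, for every plaquette `p` and `0 < β < 9/50`,
`d/dβ Σ_q Cov_{μ_β}(W_p, W_q) = 2 · Σ_q Σ_r u₃(W_p; W_q; W_r)_{μ_β}` (C-DIFF2 at `β_W = 2β`, chain rule). -/
theorem su2_hasDerivAt_susceptibility_tree
    {μ : ℝ → Measure (LGConfig 4 (Matrix.specialUnitaryGroup (Fin 2) ℂ))}
    (hμ : ∀ β ∈ Icc (0 : ℝ) (9 / 50), μ β ∈ ymGibbsMeasures (d := 4) (fundamentalRep (Fin 2)) β)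
    (p : ZdPlaquette 4) {β : ℝ} (hβ : β ∈ Ioo (0 : ℝ) (9 / 50)) :
    HasDerivAt (fun t => ∑' q : ZdPlaquette 4, cov[W∗ p, W∗ q; μ t])
      (2 * ∑' q : ZdPlaquette 4, ∑' r : ZdPlaquette 4, (cov[fun U => (W∗ p) U * (W∗ q) U, W∗ r; μ β] -
        (∫ U, (W∗ p) U ∂(μ β)) * cov[W∗ q, W∗ r; μ β] - (∫ U, (W∗ q) U ∂(μ β)) * cov[W∗ p, W∗ r; μ β])) β := by
  -- the `β_W`-indexed selection `β_W ↦ μ (2 (β_W / 4))`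
  have hμW : ∀ βW ∈ Icc (0 : ℝ) (9 / 25),
      μ (2 * (βW / 4)) ∈ ymGibbsMeasures (d := 4) (fundamentalRep (Fin 2)) (2 * (βW / 4)) :=
    fun βW hβW => hμ _ ⟨by linarith [hβW.1], by linarith [hβW.2]⟩
  have hW := su2_hasDerivAt_responseSum_star le_rfl hμW (isLipschitzCylinder_zdPlaquetteObs (N := 2) p.1 p.2.2)
    (x₀ := p.1) (D := 1) (fun e he => by simpa using norm_fst_sub_le_of_mem_plaquetteEdges he)
    (βW := 2 * β) ⟨by linarith [hβ.1], by linarith [hβ.2]⟩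
  rw [show (2 : ℝ) * (2 * β / 4) = β by ring] at hW
  have hinner : HasDerivAt (fun t : ℝ => 2 * t) 2 β := by
    simpa using (hasDerivAt_id β).const_mul (2 : ℝ)
  have hcomp := HasDerivAt.comp β
    (h₂ := fun s => ∑' q : ZdPlaquette 4, cov[W∗ p, W∗ q; μ (2 * (s / 4))]) (h := fun t : ℝ => 2 * t) hW hinner
  have hfun : ((fun s => ∑' q : ZdPlaquette 4, cov[W∗ p, W∗ q; μ (2 * (s / 4))]) ∘ fun t : ℝ => 2 * t) =
      fun t => ∑' q : ZdPlaquette 4, cov[W∗ p, W∗ q; μ t] := by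
    funext t
    simp only [Function.comp_def]
    rw [show (2 : ℝ) * (2 * t / 4) = t by ring]
  rw [hfun] at hcomp
  refine hcomp.congr_deriv ?_
  ring

/-- ★ **The plaquette susceptibility `Σ_{i<j} 4 Σ_q Cov(W_{p_ij}, W_q)` is differentiable in the coupling** along any DLR
selection on `[0, 9/50]`, with derivative `Σ_{i<j} 4 · 2 · Σ_q Σ_r u₃(W_{p_ij}; W_q; W_r)` at every `0 < β < 9/50`. -/
theorem su2_hasDerivAt_susceptibilitySum
    {μ : ℝ → Measure (LGConfig 4 (Matrix.specialUnitaryGroup (Fin 2) ℂ))}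
    (hμ : ∀ β ∈ Icc (0 : ℝ) (9 / 50), μ β ∈ ymGibbsMeasures (d := 4) (fundamentalRep (Fin 2)) β)
    {β : ℝ} (hβ : β ∈ Ioo (0 : ℝ) (9 / 50)) :
    HasDerivAt (fun t => ∑ q : 𝔓₄, 4 * ∑' r : ZdPlaquette 4, cov[zdPlaquetteObs (fundamentalRep (Fin 2)) 0 q.1.1 q.1.2,
        zdPlaquetteObs (fundamentalRep (Fin 2)) r.1 r.2.1.1 r.2.1.2; μ t])
      (∑ q : 𝔓₄, 4 * (2 * ∑' s : ZdPlaquette 4, ∑' r : ZdPlaquette 4,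
        (cov[fun U => (W∗ ((0 : Literature.Probability.LatticeModels.Site 4), q)) U * (W∗ s) U, W∗ r; μ β] -
          (∫ U, (W∗ ((0 : Literature.Probability.LatticeModels.Site 4), q)) U ∂(μ β)) * cov[W∗ s, W∗ r; μ β] -
          (∫ U, (W∗ s) U ∂(μ β)) * cov[W∗ ((0 : Literature.Probability.LatticeModels.Site 4), q), W∗ r; μ β]))) β :=
  HasDerivAt.fun_sum (u := (Finset.univ : Finset 𝔓₄)) fun q _ =>
    (su2_hasDerivAt_susceptibility_tree hμ ((0 : Literature.Probability.LatticeModels.Site 4), q) hβ).const_mul 4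

/-- ★★ **`SU(2)`, `d = 4`: the free energy density is THREE TIMES differentiable at every `0 < β < 9/50`, with
`f'''(β) = Σ_{i<j} 4 · 2 · Σ_q Σ_r u₃(W_{p_ij}; W_q; W_r)_{μ_β}` — the summed connected three-point function of the
plaquette field under the unique DLR state (absolutely convergent by C-SUS3).** -/
theorem su2_hasDerivAt_deriv_deriv_freeEnergyDensity
    {μ : ℝ → Measure (LGConfig 4 (Matrix.specialUnitaryGroup (Fin 2) ℂ))}
    (hμ : ∀ β ∈ Icc (0 : ℝ) (9 / 50), μ β ∈ ymGibbsMeasures (d := 4) (fundamentalRep (Fin 2)) β)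
    {β : ℝ} (hβ : β ∈ Ioo (0 : ℝ) (9 / 50)) :
    HasDerivAt (deriv (deriv (freeEnergyDensity 4 (fundamentalRep (Fin 2)))))
      (∑ q : 𝔓₄, 4 * (2 * ∑' s : ZdPlaquette 4, ∑' r : ZdPlaquette 4,
        (cov[fun U => (W∗ ((0 : Literature.Probability.LatticeModels.Site 4), q)) U * (W∗ s) U, W∗ r; μ β] -
          (∫ U, (W∗ ((0 : Literature.Probability.LatticeModels.Site 4), q)) U ∂(μ β)) * cov[W∗ s, W∗ r; μ β] -
          (∫ U, (W∗ s) U ∂(μ β)) * cov[W∗ ((0 : Literature.Probability.LatticeModels.Site 4), q), W∗ r; μ β]))) β := by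
  refine (su2_hasDerivAt_susceptibilitySum hμ hβ).congr_of_eventuallyEq ?_
  filter_upwards [Ioo_mem_nhds hβ.1 hβ.2] with t ht
  exact su2_deriv_deriv_freeEnergyDensity_eq ht (hμ t ⟨ht.1.le, ht.2.le⟩)

/-- **The third thermodynamic identity at EVERY coupling of the open window**:
`f'''(β) = Σ_{i<j} 8 Σ_q Σ_r u₃(W_{p_ij}; W_q; W_r)_ν` for every DLR state `ν ∈ 𝒢(β)`, `0 < β < 9/50`. -/
theorem su2_deriv_deriv_deriv_freeEnergyDensity_eq {β : ℝ} (hβ : β ∈ Ioo (0 : ℝ) (9 / 50))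
    {ν : Measure (LGConfig 4 (Matrix.specialUnitaryGroup (Fin 2) ℂ))}
    (hν : ν ∈ ymGibbsMeasures (d := 4) (fundamentalRep (Fin 2)) β) :
    deriv (deriv (deriv (freeEnergyDensity 4 (fundamentalRep (Fin 2))))) β =
      ∑ q : 𝔓₄, 4 * (2 * ∑' s : ZdPlaquette 4, ∑' r : ZdPlaquette 4,
        (cov[fun U => (W∗ ((0 : Literature.Probability.LatticeModels.Site 4), q)) U * (W∗ s) U, W∗ r; ν] -
          (∫ U, (W∗ ((0 : Literature.Probability.LatticeModels.Site 4), q)) U ∂ν) * cov[W∗ s, W∗ r; ν] -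
          (∫ U, (W∗ s) U ∂ν) * cov[W∗ ((0 : Literature.Probability.LatticeModels.Site 4), q), W∗ r; ν])) := by
  classical
  obtain ⟨μ, hμ⟩ := exists_dlrSelection
  set μ' : ℝ → Measure (LGConfig 4 (Matrix.specialUnitaryGroup (Fin 2) ℂ)) :=
    fun t => if t = β then ν else μ (2 * t) with hμ'
  have hμ'sel : ∀ t ∈ Icc (0 : ℝ) (9 / 50), μ' t ∈ ymGibbsMeasures (d := 4) (fundamentalRep (Fin 2)) t := by
    intro t _
    by_cases ht : t = β
    · simp only [hμ', ht, if_true]; exact hν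
    · simp only [hμ', ht, if_false]
      have h := hμ (2 * t)
      rwa [show (2 : ℝ) * (2 * t / 4) = t by ring] at h
  have h := (su2_hasDerivAt_deriv_deriv_freeEnergyDensity hμ'sel hβ).deriv
  simpa [hμ'] using h

/-- **`f'''` is continuous on the closed window** (tree coupling): along any DLR selection on `[0, 9/50]`,
`β ↦ Σ_{i<j} 4 · 2 · Σ_q Σ_r u₃(W_{p_ij}; W_q; W_r)_{μ_β}` is continuous on `[0, 9/50]` (this seat's
`su2_continuousOn_threePointSum` at `β_W = 2β`). -/
theorem su2_continuousOn_thirdResponse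
    {μ : ℝ → Measure (LGConfig 4 (Matrix.specialUnitaryGroup (Fin 2) ℂ))}
    (hμ : ∀ β ∈ Icc (0 : ℝ) (9 / 50), μ β ∈ ymGibbsMeasures (d := 4) (fundamentalRep (Fin 2)) β) :
    ContinuousOn (fun β => ∑ q : 𝔓₄, 4 * (2 * ∑' s : ZdPlaquette 4, ∑' r : ZdPlaquette 4,
        (cov[fun U => (W∗ ((0 : Literature.Probability.LatticeModels.Site 4), q)) U * (W∗ s) U, W∗ r; μ β] -
          (∫ U, (W∗ ((0 : Literature.Probability.LatticeModels.Site 4), q)) U ∂(μ β)) * cov[W∗ s, W∗ r; μ β] -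
          (∫ U, (W∗ s) U ∂(μ β)) * cov[W∗ ((0 : Literature.Probability.LatticeModels.Site 4), q), W∗ r; μ β])))
      (Icc (0 : ℝ) (9 / 50)) := by
  have hμW : ∀ βW ∈ Icc (0 : ℝ) (9 / 25),
      μ (2 * (βW / 4)) ∈ ymGibbsMeasures (d := 4) (fundamentalRep (Fin 2)) (2 * (βW / 4)) :=
    fun βW hβW => hμ _ ⟨by linarith [hβW.1], by linarith [hβW.2]⟩
  refine continuousOn_finsetSum _ fun q _ => continuousOn_const.mul (continuousOn_const.mul ?_)
  have hW := su2_continuousOn_threePointSum le_rfl hμW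
    (isLipschitzCylinder_zdPlaquetteObs (N := 2) (0 : Literature.Probability.LatticeModels.Site 4) q.2)
    (x₀ := 0) (D := 1) (fun e he => by simpa using norm_fst_sub_le_of_mem_plaquetteEdges he)
  have h2 : Continuous (fun β : ℝ => 2 * β) := continuous_const.mul continuous_id
  have hcomp := hW.comp h2.continuousOn
    (fun β (hβ : β ∈ Icc (0 : ℝ) (9 / 50)) => show (2 : ℝ) * β ∈ Icc (0 : ℝ) (9 / 25) from
      ⟨by linarith [hβ.1], by linarith [hβ.2]⟩)
  refine hcomp.congr fun β _ => ?_
  simp only [Function.comp_def]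
  rw [show (2 : ℝ) * (2 * β / 4) = β by ring]

/-- `f'` is differentiable on the open window (part 2). -/
theorem su2_differentiableOn_deriv_freeEnergyDensity :
    DifferentiableOn ℝ (deriv (freeEnergyDensity 4 (fundamentalRep (Fin 2)))) (Ioo (0 : ℝ) (9 / 50)) := by
  obtain ⟨μ, hμ⟩ := exists_dlrSelection
  have hμsel : ∀ t ∈ Icc (0 : ℝ) (9 / 50), μ (2 * t) ∈ ymGibbsMeasures (d := 4) (fundamentalRep (Fin 2)) t := by
    intro t _
    have h := hμ (2 * t)
    rwa [show (2 : ℝ) * (2 * t / 4) = t by ring] at h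
  exact fun β hβ => (su2_hasDerivAt_deriv_freeEnergyDensity hμsel hβ).differentiableAt.differentiableWithinAt

/-- ★★ **`f ∈ C³` on the open window**: `ContDiffOn ℝ 3 (freeEnergyDensity 4 ρ_{SU(2)}) (0, 9/50)` — NO FIRST-, SECOND- OR
THIRD-ORDER TRANSITION on the strong-coupling window `0 < β_W < 9/25`, as a kernel theorem about the thermodynamic
potential. -/
theorem su2_contDiffOn_three_freeEnergyDensity :
    ContDiffOn ℝ 3 (freeEnergyDensity 4 (fundamentalRep (Fin 2))) (Ioo (0 : ℝ) (9 / 50)) := by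
  obtain ⟨μ, hμ⟩ := exists_dlrSelection
  have hμsel : ∀ t ∈ Icc (0 : ℝ) (9 / 50), μ (2 * t) ∈ ymGibbsMeasures (d := 4) (fundamentalRep (Fin 2)) t := by
    intro t _
    have h := hμ (2 * t)
    rwa [show (2 : ℝ) * (2 * t / 4) = t by ring] at h
  rw [show (3 : WithTop ℕ∞) = 2 + 1 from rfl, contDiffOn_succ_iff_deriv_of_isOpen isOpen_Ioo]
  refine ⟨su2_differentiableOn_freeEnergyDensity, fun h => absurd h (by simp), ?_⟩
  rw [show (2 : WithTop ℕ∞) = 1 + 1 from rfl, contDiffOn_succ_iff_deriv_of_isOpen isOpen_Ioo]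
  refine ⟨su2_differentiableOn_deriv_freeEnergyDensity, fun h => absurd h (by simp), ?_⟩
  exact CouplingResponse.contDiffOn_one_of_hasDerivAt
    (fun t ht => su2_hasDerivAt_deriv_deriv_freeEnergyDensity hμsel ht) (su2_continuousOn_thirdResponse hμsel)

/-- ★ **Wilson normalisation**: `g(β_W) := f(β_W/2)` is `C³` on `(0, 9/25)`. -/
theorem su2_wilson_contDiffOn_three :
    ContDiffOn ℝ 3 (fun βW : ℝ => freeEnergyDensity 4 (fundamentalRep (Fin 2)) (βW / 2)) (Ioo (0 : ℝ) (9 / 25)) := by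
  refine su2_contDiffOn_three_freeEnergyDensity.comp (contDiff_id.div_const (2 : ℝ)).contDiffOn fun βW hβW => ?_
  exact ⟨by simpa using hβW.1, by linarith [hβW.2]⟩

end SU2C3

end Summit.Ventures.YMGap.PressureRegularity

end
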